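import Summits.NavierStokesRegularity.NavierStokesRegularity.Theses.ContinuousAlignment
import Summits.NavierStokesRegularity.NavierStokesRegularity.Theorems.NoBlowupToClay

/-!
# Route ContinuousAlignment — `NoBlowupToClay` (item stmt-NavierStokesRegularity-15607)

The shared frame support item of the positive Navier–Stokes routes, here for route
`ContinuousAlignment`:

  `NoBlowup → NavierStokesRegularity`,

where `NoBlowup` says that every classical solution of the unforced Navier–Stokes system on
`ℝ³ × [0, T)` which is Leray–Hopf on `[0, T]` from a rapidly decaying datum extends smoothly past
`T`, and `NavierStokesRegularity` is Fefferman's Clay statement (A).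

The item is byte-identical to the shared item stmt-NavierStokesRegularity-0055, which is proved in
the tree, route-independently, by
`Summit.NavierStokesRegularity.NavierStokesRegularity.Theorems.navierStokesRegularity_of_noBlowup`
(`Theorems/NoBlowupToClay.lean`: Kato maximal-time dichotomy; a global Kato `C_t L³` solution is a
Clay solution, while a finite maximal time carries a Lemarié-Rieusset singular point that the
hypothesised smooth continuation of the grafted classical Leray–Hopf solution excludes). This file
only instantiates that theorem at the route's copy of the decl.

## References

* J. Leray, Acta Math. 63 (1934), §III and Ch. V §31.
* C. L. Fefferman, *Existence and smoothness of the Navier–Stokes equation*, Clay (2000/2006), (A).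
* P. G. Lemarié-Rieusset, *The Navier–Stokes Problem in the 21st Century*, CRC 2016, Prop. 12.3,
  Thm. 15.1 (C).
-/

namespace Summit.NavierStokesRegularity.NavierStokesRegularity.Theorems

/-- **`NoBlowupToClay`** for route `ContinuousAlignment` (item stmt-NavierStokesRegularity-15607,
verbatim the shared item stmt-NavierStokesRegularity-0055): if every classical solution of the
unforced Navier–Stokes system on `ℝ³ × [0, T)` which is Leray–Hopf on `[0, T]` from a rapidly
decaying datum extends smoothly past `T`, then Fefferman's Clay statement (A) holds. Proof: the
route decl unfolds to the type of the route-independent tree theorem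
`navierStokesRegularity_of_noBlowup`. -/
theorem continuousAlignment_noBlowupToClay_proof :
    Summit.NavierStokesRegularity.NavierStokesRegularity.Theses.ContinuousAlignment.NoBlowupToClay := by
  unfold Summit.NavierStokesRegularity.NavierStokesRegularity.Theses.ContinuousAlignment.NoBlowupToClay
  exact navierStokesRegularity_of_noBlowup

end Summit.NavierStokesRegularity.NavierStokesRegularity.Theorems
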